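import Literature.Geometry.Symplectic.GrayStabilityLinear
import Mathlib.Analysis.Calculus.Deriv.Add
import Mathlib.Analysis.Calculus.Deriv.Comp
import Mathlib.Analysis.Calculus.Deriv.Mul
import Mathlib.Analysis.Calculus.Deriv.Prod
import Mathlib.Analysis.Calculus.FDeriv.Symmetric
import Mathlib.Analysis.Calculus.FDeriv.CompCLM
import Mathlib.Analysis.Calculus.DifferentialForm.Basic
import Mathlib.Analysis.ODE.Gronwall
import HarnessLib

/-!
# Gray stability, III: the derivative of `ψ_t^* α_t` along the Moser flow, in coordinates

Topic `Literature/Geometry/Symplectic`; third of the files proving the named fact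
`Literature.Geometry.Symplectic.GrayStability` (Gray 1959; Geiges, *An Introduction to Contact
Topology* (2008), Thm. 2.2.2, p. 60) by the Moser trick.

Geiges (2008), Lemma 2.2.1: for a smooth family of forms `ω_t` and an isotopy `ψ_t` with
`X_t ∘ ψ_t = ψ̇_t`, `d/dt (ψ_t^* ω_t) = ψ_t^*(ω̇_t + L_{X_t} ω_t)`; in the proof of Thm. 2.2.2
this is combined with Cartan's formula and `X_t ∈ ker α_t` to get
`d/dt (ψ_t^* α_t) = ψ_t^*(α̇_t + i_{X_t} dα_t) = ψ_t^*(μ_t α_t)`, so that `ψ_t^* α_t = λ_t α_0`.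

This file proves the **coordinate form of that computation, evaluated on one tangent vector**
(which is all `GrayStability` — a statement about kernels — needs), as pure calculus on the model
space `ℝ × 𝔼 3`: for a family of `1`-forms `A (t, q)` (the chart representative of `α_t`), a
time-dependent vector field `X (t, q)` (the Moser field read in the chart), a scalar `μ`, and a
map `Q (t, p)` (the flow read in charts) with `∂_t Q = X(t, Q)`, the pairing
`f(t) = A(t, Q(t, p₀)) [∂_p Q(t, p₀) v]` — i.e. `(ψ_t^* α_t)_{p₀}(v)` — satisfies
`f'(t) = μ(t, Q(t, p₀)) · f(t)` (`hasDerivAt_trackPairing`), provided `A(X) = 0` and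
`∂_t A + i_X dA = μ A` (the Moser equation (2.2)). The ingredients are the chain rule, the
symmetry of second derivatives of `Q` (the variational equation `∂_t ∂_p Q = ∂_q X ∘ ∂_p Q`),
and the Leibniz rule for `A(X) = 0`.

It also records the two elementary real-variable facts that turn `f' = μ f` into
"`f(t) = 0 ↔ f(0) = 0`": local uniqueness by Grönwall in both time directions
(`eventually_eq_zero_of_hasDerivAt_mul`) and the connectedness argument on an interval
(`eq_zero_iff_of_locally`).

Everything here is proved; no named facts.

## References

* H. Geiges, *An Introduction to Contact Topology*, CUP (2008), Lemma 2.2.1, Thm. 2.2.2 and its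
  proof, pp. 59–61. [Geiges2008]
-/

noncomputable section

open scoped Topology
open Set Function Filter

namespace Literature.Geometry.Symplectic

/-- Local notation: `𝔼 n` is the model Euclidean space `EuclideanSpace ℝ (Fin n)`. -/
local notation "𝔼 " n:arg => EuclideanSpace ℝ (Fin n)

namespace GrayMoser

/-! ### Elementary real-variable lemmas -/

/-- **Local uniqueness for `g' = m g`** (Grönwall in both time directions): if `g' = m · g` near
`t₀` with `m` locally bounded and `g(t₀) = 0`, then `g = 0` near `t₀`. [folklore] -/
theorem eventually_eq_zero_of_hasDerivAt_mul {g m : ℝ → ℝ} {t₀ K : ℝ}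
    (hg : ∀ᶠ t in 𝓝 t₀, HasDerivAt g (m t * g t) t) (hm : ∀ᶠ t in 𝓝 t₀, |m t| ≤ K)
    (h0 : g t₀ = 0) : ∀ᶠ t in 𝓝 t₀, g t = 0 := by
  obtain ⟨ε, hε, hball⟩ := Metric.eventually_nhds_iff_ball.1 (hg.and hm)
  have hbound : ∀ t ∈ Metric.ball t₀ ε, ‖m t * g t‖ ≤ K * ‖g t‖ := fun t ht ↦ by
    rw [norm_mul, Real.norm_eq_abs, Real.norm_eq_abs]
    exact mul_le_mul_of_nonneg_right (hball t ht).2 (abs_nonneg _)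
  -- forward
  have hfwd : ∀ t ∈ Icc t₀ (t₀ + ε / 2), g t = 0 := by
    have hsub : Icc t₀ (t₀ + ε / 2) ⊆ Metric.ball t₀ ε := fun t ht ↦ by
      rw [Metric.mem_ball, Real.dist_eq, abs_lt]
      constructor <;> linarith [ht.1, ht.2]
    refine eq_zero_of_abs_deriv_le_mul_abs_self_of_eq_zero_right (K := K)
      (f' := fun t ↦ m t * g t) ?_ ?_ h0 ?_
    · exact fun t ht ↦ ((hball t (hsub ht)).1.continuousAt).continuousWithinAt
    · exact fun t ht ↦ ((hball t (hsub (Ico_subset_Icc_self ht))).1).hasDerivWithinAt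
    · exact fun t ht ↦ hbound t (hsub (Ico_subset_Icc_self ht))
  -- backward: `s ↦ g (t₀ - s)` on `[0, ε / 2]`
  have hbwd : ∀ s ∈ Icc (0 : ℝ) (ε / 2), g (t₀ - s) = 0 := by
    have hsub : ∀ s ∈ Icc (0 : ℝ) (ε / 2), t₀ - s ∈ Metric.ball t₀ ε := fun s hs ↦ by
      rw [Metric.mem_ball, Real.dist_eq, abs_lt]
      constructor <;> linarith [hs.1, hs.2]
    have hder : ∀ s ∈ Icc (0 : ℝ) (ε / 2),
        HasDerivAt (fun s ↦ g (t₀ - s)) (-(m (t₀ - s)) * g (t₀ - s)) s := fun s hs ↦ by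
      have h := (hball _ (hsub s hs)).1
      exact (h.comp s ((hasDerivAt_id s).const_sub t₀)).congr_deriv (by ring)
    refine eq_zero_of_abs_deriv_le_mul_abs_self_of_eq_zero_right (K := K)
      (f := fun s ↦ g (t₀ - s)) (f' := fun s ↦ -(m (t₀ - s)) * g (t₀ - s)) ?_ ?_ (by simpa) ?_
    · exact fun s hs ↦ (hder s hs).continuousAt.continuousWithinAt
    · exact fun s hs ↦ (hder s (Ico_subset_Icc_self hs)).hasDerivWithinAt
    · intro s hs
      have h := hbound _ (hsub s (Ico_subset_Icc_self hs))
      rwa [norm_mul, norm_neg, ← norm_mul]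
  rw [Metric.eventually_nhds_iff_ball]
  refine ⟨ε / 2, by positivity, fun t ht ↦ ?_⟩
  rw [Metric.mem_ball, Real.dist_eq, abs_lt] at ht
  rcases le_or_gt t₀ t with hle | hlt
  · exact hfwd t ⟨hle, by linarith [ht.2]⟩
  · have h := hbwd (t₀ - t) ⟨by linarith, by linarith [ht.1]⟩
    rwa [sub_sub_cancel] at h

/-- **The connectedness step**: if `g` is continuous on `(a, b)` and its zero set there is open
(local uniqueness), then `g` vanishes at one point of `(a, b)` iff it vanishes at any other.
[folklore] -/
theorem eq_zero_iff_of_locally {g : ℝ → ℝ} {a b : ℝ} (hcont : ContinuousOn g (Ioo a b))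
    (hloc : ∀ t₀ ∈ Ioo a b, g t₀ = 0 → ∀ᶠ t in 𝓝 t₀, g t = 0) {s t : ℝ} (hs : s ∈ Ioo a b)
    (ht : t ∈ Ioo a b) : g s = 0 ↔ g t = 0 := by
  -- the zero set and its complement in `(a, b)` are open
  have hU : IsOpen {x | x ∈ Ioo a b ∧ g x = 0} := by
    rw [isOpen_iff_mem_nhds]
    rintro x ⟨hx, hx0⟩
    filter_upwards [isOpen_Ioo.mem_nhds hx, hloc x hx hx0] with y hy hy0
    exact ⟨hy, hy0⟩
  have hV : IsOpen (Ioo a b ∩ g ⁻¹' {0}ᶜ) := hcont.isOpen_inter_preimage isOpen_Ioo isOpen_compl_singleton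
  have hcover : Ioo a b ⊆ {x | x ∈ Ioo a b ∧ g x = 0} ∪ (Ioo a b ∩ g ⁻¹' {0}ᶜ) := fun x hx ↦ by
    by_cases h : g x = 0
    · exact Or.inl ⟨hx, h⟩
    · exact Or.inr ⟨hx, h⟩
  have hdisj : Disjoint {x | x ∈ Ioo a b ∧ g x = 0} (Ioo a b ∩ g ⁻¹' {0}ᶜ) := by
    rw [Set.disjoint_left]
    rintro x ⟨-, hx0⟩ ⟨-, hx1⟩
    exact hx1 hx0
  have key : ∀ {s t : ℝ}, s ∈ Ioo a b → t ∈ Ioo a b → g s = 0 → g t = 0 := by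
    intro s t hs ht hs0
    have h := isPreconnected_Ioo.subset_left_of_subset_union hU hV hdisj hcover ⟨s, hs, hs, hs0⟩
    exact (h ht).2
  exact ⟨key hs ht, key ht hs⟩

/-! ### The derivative of the transported pairing -/

section Pairing

variable {A : ℝ × 𝔼 3 → (𝔼 3) [⋀^Fin 1]→L[ℝ] ℝ} {X : ℝ × 𝔼 3 → 𝔼 3} {μ : ℝ × 𝔼 3 → ℝ}
  {Q : ℝ × 𝔼 3 → 𝔼 3} {t₀ : ℝ} {p₀ : 𝔼 3}

/-- **The transported pairing** `f(t) = A(t, Q(t, p₀)) [∂_p Q(t, p₀) v]`: with `A` the chart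
representative of `α_t`, `Q` the flow `ψ_t` read in charts and `v` a tangent vector at `p₀`,
this is `(ψ_t^* α_t)_{p₀}(v) = α_t(ψ_t p₀)[Tψ_t v]` (Geiges 2008, proof of Thm. 2.2.2). The
partial derivative `∂_p Q(t, p₀) v` is written `fderiv ℝ Q (t, p₀) (0, v)`. [cite: Geiges2008, Thm. 2.2.2 (proof)] -/
def trackPairing (A : ℝ × 𝔼 3 → (𝔼 3) [⋀^Fin 1]→L[ℝ] ℝ) (Q : ℝ × 𝔼 3 → 𝔼 3) (p₀ v : 𝔼 3)
    (t : ℝ) : ℝ :=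
  A (t, Q (t, p₀)) ![fderiv ℝ Q (t, p₀) (0, v)]

/-- `![x]` is the constant tuple. [folklore] -/
theorem vec1_eq_const (x : 𝔼 3) : (![x] : Fin 1 → 𝔼 3) = fun _ ↦ x := by
  funext i
  fin_cases i
  rfl

/-- **Leibniz rule for `A(X) = 0`**: if `A z [X z] = 0` near `z₀` then
`(D A(z₀) · u)[X z₀] + A z₀ [D X(z₀) · u] = 0` for every direction `u`. [folklore] -/
theorem fderiv_apply_add_apply_fderiv_eq_zero {z₀ : ℝ × 𝔼 3} (hA : DifferentiableAt ℝ A z₀)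
    (hX : DifferentiableAt ℝ X z₀) (h0 : ∀ᶠ z in 𝓝 z₀, A z ![X z] = 0) (u : ℝ × 𝔼 3) :
    fderiv ℝ A z₀ u ![X z₀] + A z₀ ![fderiv ℝ X z₀ u] = 0 := by
  have h1 : fderiv ℝ (fun z ↦ A z ![X z]) z₀ = 0 := by
    rw [Filter.EventuallyEq.fderiv_eq (f := fun _ ↦ (0 : ℝ)) h0, fderiv_const_apply]
  have h2 : fderiv ℝ (fun z ↦ A z ![X z]) z₀ u =
      fderiv ℝ A z₀ u ![X z₀] + A z₀ ![fderiv ℝ X z₀ u] := by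
    have h := fderiv_continuousAlternatingMap_apply_apply (g := fun _ : Fin 1 ↦ X) hA
      (fun _ ↦ hX) u
    simp only [Finset.univ_unique, Fin.default_eq_zero, Fin.isValue, Finset.sum_singleton] at h
    have e1 : (fun z ↦ A z fun _ : Fin 1 ↦ X z) = fun z ↦ A z ![X z] := by
      funext z; rw [vec1_eq_const]
    have e2 : Function.update (fun _ : Fin 1 ↦ X z₀) 0 (fderiv ℝ X z₀ u) =
        ![fderiv ℝ X z₀ u] := by
      funext i; fin_cases i; simp
    rw [e1, e2, ← vec1_eq_const] at h
    exact h
  rw [← h2, h1]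
  rfl

/-- **`f' = μ f` for the transported pairing** (Geiges 2008, Lemma 2.2.1 with the proof of
Thm. 2.2.2, in coordinates and evaluated on one vector). Hypotheses, all near the relevant
points: `A` and `Q` are `C²`, `X` is `C¹`; the flow equation `∂_t Q = X(t, Q)`; `A(X) = 0`
(`X_t ∈ ker α_t`); and the Moser equation `∂_t A(w) + dA(X, w) = μ A(w)` written with Fréchet
derivatives (`dA(X, w) = (D A · (0, X))(w) - (D A · (0, w))(X)`, Mathlib's normalisation of
`extDeriv`). Conclusion: `f'(t₀) = μ(t₀, Q(t₀, p₀)) f(t₀)`. [cite: Geiges2008, Lemma 2.2.1 and Thm. 2.2.2 (proof)] -/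
theorem hasDerivAt_trackPairing (v : 𝔼 3)
    (hA : ContDiffAt ℝ 2 A (t₀, Q (t₀, p₀))) (hX : ContDiffAt ℝ 1 X (t₀, Q (t₀, p₀)))
    (hQ : ContDiffAt ℝ 2 Q (t₀, p₀))
    (hflow : ∀ᶠ z in 𝓝 (t₀, p₀), fderiv ℝ Q z (1, 0) = X (z.1, Q z))
    (hI1 : ∀ᶠ z in 𝓝 (t₀, Q (t₀, p₀)), A z ![X z] = 0)
    (hI2 : ∀ w, fderiv ℝ A (t₀, Q (t₀, p₀)) (1, 0) ![w] +
      (fderiv ℝ A (t₀, Q (t₀, p₀)) (0, X (t₀, Q (t₀, p₀))) ![w] -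
        fderiv ℝ A (t₀, Q (t₀, p₀)) (0, w) ![X (t₀, Q (t₀, p₀))]) =
      μ (t₀, Q (t₀, p₀)) * A (t₀, Q (t₀, p₀)) ![w]) :
    HasDerivAt (trackPairing A Q p₀ v)
      (μ (t₀, Q (t₀, p₀)) * trackPairing A Q p₀ v t₀) t₀ := by
  set q₀ := Q (t₀, p₀) with hq₀
  set X₀ := X (t₀, q₀) with hX₀
  -- derivatives of `Q` and of `Φ = fderiv Q`
  set Φ := fderiv ℝ Q with hΦ
  have hQd : HasFDerivAt Q (Φ (t₀, p₀)) (t₀, p₀) := (hQ.differentiableAt (by simp)).hasFDerivAt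
  have hQ' : ContDiffAt ℝ (1 + 1) Q (t₀, p₀) := by rw [one_add_one_eq_two]; exact hQ
  have hΦd : HasFDerivAt Φ (fderiv ℝ Φ (t₀, p₀)) (t₀, p₀) :=
    (hQ'.fderiv_right_succ.differentiableAt (by simp)).hasFDerivAt
  have hc₁ : HasDerivAt (fun t : ℝ ↦ ((t, p₀) : ℝ × 𝔼 3)) ((1 : ℝ), (0 : 𝔼 3)) t₀ :=
    (hasDerivAt_id t₀).prodMk (hasDerivAt_const t₀ p₀)
  -- the flow equation at the base point: `q'(t₀) = X₀`
  have hflow₀ : Φ (t₀, p₀) (1, 0) = X₀ := hflow.self_of_nhds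
  have hq : HasDerivAt (fun t ↦ Q (t, p₀)) X₀ t₀ := by
    have h := hQd.comp_hasDerivAt t₀ hc₁
    rwa [hflow₀] at h
  -- `w(t) = Φ (t, p₀) (0, v)` and its derivative `∂_q X · w` (variational equation)
  set w₀ := Φ (t₀, p₀) (0, v) with hw₀
  have hw : HasDerivAt (fun t ↦ Φ (t, p₀) (0, v)) (fderiv ℝ X (t₀, q₀) (0, w₀)) t₀ := by
    have h1 : HasDerivAt (fun t ↦ Φ (t, p₀)) (fderiv ℝ Φ (t₀, p₀) (1, 0)) t₀ :=
      hΦd.comp_hasDerivAt t₀ hc₁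
    have h2 : HasDerivAt (fun t ↦ Φ (t, p₀) (0, v)) (fderiv ℝ Φ (t₀, p₀) (1, 0) (0, v)) t₀ := by
      simpa using h1.clm_apply (hasDerivAt_const t₀ ((0 : ℝ), v))
    refine h2.congr_deriv ?_
    -- symmetry of second derivatives, then differentiate the flow equation in `p`
    rw [(hQ.isSymmSndFDerivAt (by simp)).eq (1, 0) (0, v)]
    have h3 : fderiv ℝ Φ (t₀, p₀) (0, v) (1, 0) =
        fderiv ℝ (fun z ↦ Φ z (1, 0)) (t₀, p₀) (0, v) := by
      rw [fderiv_clm_apply hΦd.differentiableAt (differentiableAt_const _)]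
      simp
    rw [h3, Filter.EventuallyEq.fderiv_eq (hflow : (fun z ↦ Φ z (1, 0)) =ᶠ[𝓝 (t₀, p₀)]
      fun z ↦ X (z.1, Q z))]
    have h4 : HasFDerivAt (fun z : ℝ × 𝔼 3 ↦ ((z.1, Q z) : ℝ × 𝔼 3))
        ((ContinuousLinearMap.fst ℝ ℝ (𝔼 3)).prod (Φ (t₀, p₀))) (t₀, p₀) :=
      hasFDerivAt_fst.prodMk hQd
    have h5 : HasFDerivAt X (fderiv ℝ X (t₀, q₀)) (t₀, Q (t₀, p₀)) :=
      (hX.differentiableAt (by simp)).hasFDerivAt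
    have h45 : HasFDerivAt (fun z : ℝ × 𝔼 3 ↦ X (z.1, Q z))
        ((fderiv ℝ X (t₀, q₀)).comp ((ContinuousLinearMap.fst ℝ ℝ (𝔼 3)).prod (Φ (t₀, p₀))))
        (t₀, p₀) := h5.comp (t₀, p₀) h4
    rw [h45.fderiv, hw₀]
    rfl
  -- `a(t) = A (t, Q (t, p₀))` and its derivative
  have hAd : HasFDerivAt A (fderiv ℝ A (t₀, q₀)) (t₀, q₀) :=
    (hA.differentiableAt (by simp)).hasFDerivAt
  have ha : HasDerivAt (fun t ↦ A (t, Q (t, p₀))) (fderiv ℝ A (t₀, q₀) (1, X₀)) t₀ := by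
    have h := hAd.comp_hasDerivAt t₀ ((hasDerivAt_id t₀).prodMk hq)
    exact h
  -- the pairing in coordinates: `f t = Σᵢ wᵢ(t) · a(t)(eᵢ)`
  have hf : trackPairing A Q p₀ v = fun t ↦
      Φ (t, p₀) (0, v) 0 * A (t, Q (t, p₀)) ![e 0] + Φ (t, p₀) (0, v) 1 * A (t, Q (t, p₀)) ![e 1]
        + Φ (t, p₀) (0, v) 2 * A (t, Q (t, p₀)) ![e 2] := by
    funext t
    rw [trackPairing, apply_one]
  -- derivative of each coordinate and of each evaluation
  have hwi : ∀ i : Fin 3, HasDerivAt (fun t ↦ Φ (t, p₀) (0, v) i)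
      (fderiv ℝ X (t₀, q₀) (0, w₀) i) t₀ := fun i ↦ by
    have h := (EuclideanSpace.proj (𝕜 := ℝ) i).hasFDerivAt.comp_hasDerivAt t₀ hw
    exact h
  have hai : ∀ i : Fin 3, HasDerivAt (fun t ↦ A (t, Q (t, p₀)) ![e i])
      (fderiv ℝ A (t₀, q₀) (1, X₀) ![e i]) t₀ := fun i ↦ by
    have h := (ContinuousAlternatingMap.apply ℝ (𝔼 3) ℝ ![e i]).hasFDerivAt.comp_hasDerivAt t₀ ha
    exact h
  have hsum := (((hwi 0).mul (hai 0)).add ((hwi 1).mul (hai 1))).add ((hwi 2).mul (hai 2))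
  rw [hf]
  refine hsum.congr_deriv ?_
  -- algebra: Leibniz for `A(X) = 0`, linearity, and the Moser equation
  have hK := fderiv_apply_add_apply_fderiv_eq_zero hAd.differentiableAt
    (hX.differentiableAt (by simp)) hI1 (0, w₀)
  have hlin : fderiv ℝ A (t₀, q₀) (1, X₀) =
      fderiv ℝ A (t₀, q₀) (1, 0) + fderiv ℝ A (t₀, q₀) (0, X₀) := by
    rw [← map_add, Prod.mk_add_mk, add_zero, zero_add]
  have hμ := hI2 w₀
  have e1 : fderiv ℝ X (t₀, q₀) (0, w₀) 0 * A (t₀, Q (t₀, p₀)) ![e 0] +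
      fderiv ℝ X (t₀, q₀) (0, w₀) 1 * A (t₀, Q (t₀, p₀)) ![e 1] +
      fderiv ℝ X (t₀, q₀) (0, w₀) 2 * A (t₀, Q (t₀, p₀)) ![e 2] =
      A (t₀, q₀) ![fderiv ℝ X (t₀, q₀) (0, w₀)] := by
    rw [apply_one (A (t₀, q₀)) (fderiv ℝ X (t₀, q₀) (0, w₀))]
  have e2 : ∀ B : (𝔼 3) [⋀^Fin 1]→L[ℝ] ℝ, w₀ 0 * B ![e 0] + w₀ 1 * B ![e 1] + w₀ 2 * B ![e 2] =
      B ![w₀] := fun B ↦ by rw [apply_one B w₀]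
  have e3 : Φ (t₀, p₀) (0, v) 0 * A (t₀, Q (t₀, p₀)) ![e 0] +
      Φ (t₀, p₀) (0, v) 1 * A (t₀, Q (t₀, p₀)) ![e 1] +
      Φ (t₀, p₀) (0, v) 2 * A (t₀, Q (t₀, p₀)) ![e 2] = A (t₀, q₀) ![w₀] := by
    rw [apply_one (A (t₀, q₀)) w₀]
  calc fderiv ℝ X (t₀, q₀) (0, w₀) 0 * A (t₀, Q (t₀, p₀)) ![e 0] +
        Φ (t₀, p₀) (0, v) 0 * fderiv ℝ A (t₀, q₀) (1, X₀) ![e 0] +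
      (fderiv ℝ X (t₀, q₀) (0, w₀) 1 * A (t₀, Q (t₀, p₀)) ![e 1] +
        Φ (t₀, p₀) (0, v) 1 * fderiv ℝ A (t₀, q₀) (1, X₀) ![e 1]) +
      (fderiv ℝ X (t₀, q₀) (0, w₀) 2 * A (t₀, Q (t₀, p₀)) ![e 2] +
        Φ (t₀, p₀) (0, v) 2 * fderiv ℝ A (t₀, q₀) (1, X₀) ![e 2])
      = A (t₀, q₀) ![fderiv ℝ X (t₀, q₀) (0, w₀)] + fderiv ℝ A (t₀, q₀) (1, X₀) ![w₀] := by
        rw [← e1, ← e2 (fderiv ℝ A (t₀, q₀) (1, X₀))]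
        ring
    _ = fderiv ℝ A (t₀, q₀) (1, 0) ![w₀] + (fderiv ℝ A (t₀, q₀) (0, X₀) ![w₀]
          - fderiv ℝ A (t₀, q₀) (0, w₀) ![X₀]) := by
        rw [hlin, ContinuousAlternatingMap.add_apply]
        linarith [hK]
    _ = μ (t₀, q₀) * A (t₀, q₀) ![w₀] := hμ
    _ = μ (t₀, Q (t₀, p₀)) * (Φ (t₀, p₀) (0, v) 0 * A (t₀, Q (t₀, p₀)) ![e 0] +
          Φ (t₀, p₀) (0, v) 1 * A (t₀, Q (t₀, p₀)) ![e 1] +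
          Φ (t₀, p₀) (0, v) 2 * A (t₀, Q (t₀, p₀)) ![e 2]) := by rw [e3]

end Pairing

end GrayMoser

end Literature.Geometry.Symplectic
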